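import Summits.BirchSwinnertonDyer.Rank1Residual.Additive.RamifiedSevenGenusCyclotomicSide
import Summits.BirchSwinnertonDyer.Rank1Residual.Additive.RamifiedSevenGenusKatoSideLevelIdentity
import Summits.BirchSwinnertonDyer.Rank1Residual.Additive.RamifiedSevenGenusProjector
import Summits.BirchSwinnertonDyer.Rank1Residual.Additive.RamifiedSevenGenusUnitInputs
import Summits.BirchSwinnertonDyer.Rank1Residual.Additive.RamifiedSevenGenusSinnottNorm
import Literature.NumberTheory.GaussSums.StickelbergerElement
import HarnessLib

set_option autoImplicit false

/-!
# `𝒞₇` genus road (crux `EllipticUnitValueSevenOfGZK`, K7r), the (5)-unit programme (SUMMON GENUS-UNIT-A5), File B3b: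
# THE MASTER IDENTITY AT LEVEL `n` (memo S6) — `Σ_{g ∈ Gal(F′ₙ/ℚ)} χ(g) log‖Φ(g·θₙ)‖ =
#   c₀·(N𝔞 − ψ(N𝔞)⁻¹)·((Σ_{a mod M} a·Ψ(a))/M)·ψ(b)·Σ_{g ∈ Gal(F′ₙ/ℚ)} χ(g) log‖Φ(g·ξₙ)‖`, `c₀ = −½`,
# ON THE OPENED VALUE PIN, CONDITIONAL ON F5 ONLY (THEOREMS ONLY)

Cell bsd-cm, seat bsd-cm-k-ty1 g26 (literature-prover); ruled memo `pub/bsd-cm/bsd-cm-k-ty1/g26/G45-typing-memo.md`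
(c225f82434dc25c5; pen D941 (ρ1)–(ρ4), D946/D948/D950/D953/D956).  ASSEMBLY of File A (p786166), B1 (p787265), B2a (p788626),
B2b (p789061), B3a: for the opened pin data (`[K:ℚ] = 2`, `x² = −7`, `ι`, `e`, `𝔣` with `N𝔣 = 7d²`, `𝔣 ∣ (7D)`, an admissible
twist `𝔞`, a representative `u` of `_𝔞z_{7^{n+1}𝔣}`, the coverage `F′ₙ ⊆ e(K(7^{n+1}𝔣))`), a complex embedding `Φ` of `ℚ̄` with
`Φ ∘ e = ι̂` (B2a), an aligned root `ζ ∈ K(7^{n+1}𝔣)` with `e ζ = ζsys n` (B1), the torsor coordinate `b` (`Φ(ζsys n) = e^{2πib/mₙ}`,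
B3a), an EVEN Dirichlet character `ψ ≠ 1` mod `mₙ = 7^{n+1}|D|` reading a character `χ` of `Gal(F′ₙ/ℚ)` at `ζsys n` (D950 shape),
an odd `Ψ` with `Ψ(k) = ψ(k)(k/7)`, the normed unit `θ = e(N_{K(𝔪ₙ)/Mₙ} u) ∈ F′ₙ` ((θN), B1) and the Sinnott unit
`ξ = sinnottNorm F′ₙ (ζsys n) 1 ∈ F′ₙ` (`d.ξu_val`):

* §1 (C10) THE LEVEL-`M` FIRST MOMENT: `firstMoment_div_eq_generalizedBernoulli` (`(Σ_{a mod M} a·Ψ(a))/M = B_{1,Ψ}`, `Ψ ≠ 1`)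
  and `evalChar_inv_stickelbergerElement` (`= Ψ⁻¹(θ(M))`, the tree's `evalChar_stickelbergerElement`): the multiplier of S6 in
  the three currencies File C/E will meet (raw sum = `generalizedBernoulli 1 Ψ` = character value of `θ(M)`), all at the SAME
  (imprimitive) level `M`.  ((C11) is the tree theorem `GenusFrame.etaOneDirichlet_even`, `RamifiedSevenGenusResidue.lean`.)
* §2 `normCharacter_eq_one_of_mem_galOver` — the norm character `ψ ∘ χ_cyc` is trivial on `Gal(K(𝔪ₙ)/Mₙ)` (reading at `g = 1`);
  ★★★ `sum_log_theta_eq_genus_mul_sum_log_xi` — THE MASTER IDENTITY (display above), `(hF5 : kato1551_kroneckerLimitFormula)`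
  FIRST; CONSTANTS: `−½ = (−¼)_{File A} × 2_{B2b halving}` = the memo's `cZero`, `ub = 1`; `ψ(b)` from B3a only.
* §3 ★★★′ `exists_masterIdentity_of_isNormedEllipticUnitFamily` — the same ON THE CLOSED PIN `IsNormedEllipticUnitFamily F θu`
  (what Files C/E consume without reopening the pin): ONE `Φ` and torsor coordinates `b n` (`Φ(ζsys n) = e^{2πi b n/mₙ}`, all
  `n`) such that the identity holds at every level for every even reading `(χ, ψ)`; `θu n` enters through `toFieldUnits`,
  `N𝔞 = F.normA`.

HONEST LABEL: a conditional theorem (on F5) about the pin's own data; no definition, no named fact, no instance; nothing closes;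
stmt-BirchSwinnertonDyer-19945 OPEN; K1ᵘ NOT proved (S7–S9 = Files C/D/E ahead); `X12.CMRamifiedSeven` NOT proved; BSD is
claimed for no curve; no summit statement is proved by this seat.

## References
* K. Kato, Astérisque 295 (2004) §15.5 (15.5.1) (p. 253), §15.14 (p. 264) [Kato2004Asterisque] — F5 as hypothesis.
* S. Lang, *Cyclotomic Fields I–II* (1990) Ch. 1 §2 (θ(m)), Ch. 2 §1 (`χ(θ) = B_{1,χ̄}`), Ch. 3 §5 [Lang1990].
* T. Tsuji, J. Number Theory 78 (1999) §6 (p. 20) [Tsuji1999]; E. de Shalit (1987) II.2, II.5 [deShalit1987].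
* Tree: File A, B1, B2a, B2b, B3a (this seat); `RamifiedSevenGenusProjector.lean` (`normal_layer`), `RamifiedSevenGenusUnitInputs.lean`
  (`finiteDimensional_layer`), `RamifiedSevenGenusSinnottNorm.lean` (`layer_le_adjoin_ζsys`), `RamifiedSevenGenusUnitSide.lean`
  (`one_lt_level`), `RamifiedSevenGenusResidue.lean` (`etaOneDirichlet_even`), `GaussSums/StickelbergerElement.lean`.
-/

noncomputable section

open scoped NumberField ComplexConjugate
open Field IsDedekindDomain NumberField
open Literature.NumberTheory.QuadraticFields (jacobiChar)
open Literature.NumberTheory.IwasawaTheory.CyclotomicUnits (rootOfUnityPow cyclotomicLogSum sinnottNorm)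
open Literature.NumberTheory.LFunctions (generalizedBernoulli)
open Literature.NumberTheory.GaussSums (StickelbergerElement.evalChar StickelbergerElement.stickelbergerElement)
open Literature.NumberTheory.NumberFields (rayClassField)
open Literature.NumberTheory.ComplexMultiplication.EllipticUnits

namespace Summit.BirchSwinnertonDyer.Rank1Residual.Additive.GenusSeven

/-! ## §1 (C10) The multiplier in three currencies, all at level `M` -/

section FirstMoment

variable {M : ℕ} [NeZero M]

/-- **`(Σ_{a mod M} a·Ψ(a))/M = B_{1,Ψ}`** for `Ψ ≠ 1` (the tree's `generalizedBernoulli_one_eq_sum_mul_val_div`): File A's raw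
first moment IS the generalized Bernoulli number of level `M`. [cite: Lang1990, Ch. 1 §3 (PDF p. 27, «B_{1,χ} = Σ ⟨c/m⟩ χ(c)»)] -/
theorem firstMoment_div_eq_generalizedBernoulli (Ψ : DirichletCharacter ℂ M) (hΨ : Ψ ≠ 1) :
    (∑ a : ZMod M, (a.val : ℂ) * Ψ a) / M = generalizedBernoulli 1 Ψ := by
  rw [Literature.NumberTheory.LFunctions.generalizedBernoulli_one_eq_sum_mul_val_div Ψ hΨ]
  congr 1
  exact Finset.sum_congr rfl fun a _ => mul_comm _ _

/-- **`Ψ⁻¹(θ(M)) = B_{1,Ψ}`**: the value of the conjugate character on the Stickelberger element of level `M` is the same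
multiplier (the tree's `evalChar_stickelbergerElement`; File C's `χ(Xₙ)` currency). [cite: Lang1990, Ch. 2 §1 (PDF p. 36, «χ(θ) = B_{1,χ̄}»)] -/
theorem evalChar_inv_stickelbergerElement (Ψ : DirichletCharacter ℂ M) (hΨ : Ψ ≠ 1) :
    StickelbergerElement.evalChar M Ψ⁻¹ (StickelbergerElement.stickelbergerElement M) = generalizedBernoulli 1 Ψ := by
  rw [Literature.NumberTheory.GaussSums.StickelbergerElement.evalChar_stickelbergerElement M Ψ⁻¹ (inv_ne_one.mpr hΨ), inv_inv]

end FirstMoment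

/-! ## §2 The master identity at level `n` -/

section Master

variable {K : Type} [Field K] [NumberField K]

/-- **The norm character `ψ ∘ χ_cyc` is trivial on `Gal(K(𝔪)/e⁻¹L)`** under the Dirichlet reading of `χ` at `e ζ`: an
element of the stabiliser is `e`-compatible with `g = 1`. [cite: Kato2004Asterisque, §15.14 (p. 264)] -/
theorem normCharacter_eq_one_of_mem_galOver {𝔪 : Ideal (𝓞 K)} {m : ℕ} [NeZero m]
    (e : AlgebraicClosure K →+* AlgebraicClosure ℚ) (L : IntermediateField ℚ (AlgebraicClosure ℚ))
    (hKL : ∀ k : K, e (algebraMap K (AlgebraicClosure K) k) ∈ L)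
    (hcov : ∀ y : AlgebraicClosure ℚ, y ∈ L → ∃ w : AlgebraicClosure K, w ∈ rayClassField K 𝔪 ∧ e w = y)
    {ζ : rayClassField K 𝔪} (hζ : IsPrimitiveRoot ζ m) (ψ : DirichletCharacter ℂ m) (χ : (L ≃ₐ[ℚ] L) →* ℂˣ)
    (hread : ∀ (σ : AlgebraicClosure ℚ ≃ₐ[ℚ] AlgebraicClosure ℚ) (g : L ≃ₐ[ℚ] L) (a : ℕ),
      (∀ y : L, ((g y : L) : AlgebraicClosure ℚ) = σ y) →
      σ (e (ζ : AlgebraicClosure K)) = e (ζ : AlgebraicClosure K) ^ a → χ g = ψ a)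
    {ρ : rayClassField K 𝔪 ≃ₐ[K] rayClassField K 𝔪} (hρ : ρ ∈ galOver (rayClassField K 𝔪) (preimageField e L hKL)) :
    (ψ.toUnitHom.comp (hζ.autToPow K)) ρ = 1 := by
  rw [normCharacter_eq_of_reading e L hcov hζ ψ χ hread ρ 1 (fun y hy => ?_), map_one]
  rw [AlgEquiv.one_apply]
  exact (congrArg e (hρ (y : AlgebraicClosure K) y.2 (by rw [mem_preimageField_iff]; exact hy))).symm

/-- ★★★ **THE MASTER IDENTITY AT LEVEL `n`** (memo S6), on the opened value pin and CONDITIONAL on F5 only: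
`Σ_{g ∈ Gal(F′ₙ/ℚ)} χ(g)·log‖Φ(g θ)‖ = −½·(N𝔞 − ψ(N𝔞)⁻¹)·((Σ_{a mod M} a·Ψ(a))/M)·ψ(b)·Σ_{g ∈ Gal(F′ₙ/ℚ)} χ(g)·log‖Φ(g ξ)‖` for
`θ = e(N_{K(𝔪ₙ)/Mₙ} u)` (= `θu n` by (θN)), `ξ = sinnottNorm F′ₙ (ζsys n) 1` (= `ξu n`), `ψ` even `≠ 1` reading `χ` at `ζsys n`,
`Ψ` odd with `Ψ(k) = ψ(k)(k/7)`.  Road: File A/B1 (F5 at `ψ∘χ_cyc`, `−¼`) → B1 §5/§6 + B2b §1 (K-side ⟶ `Σ_{g fixes e(K)}`,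
the factor `#Gal(K(𝔪ₙ)/Mₙ)` cancelling) → B2b §3 (halving, `×2`, evenness) → B3a (cyclotomic side, `ψ(b)`).
[cite: Kato2004Asterisque, §15.5 (15.5.1) (p. 253)] [cite: Lang1990, Ch. 3 §5 Lemma 1 (PDF p. 71)] [cite: Tsuji1999, §6 (p. 20)] -/
theorem sum_log_theta_eq_genus_mul_sum_log_xi (hF5 : Kato2004.kato1551_kroneckerLimitFormula) (F : GenusFrame)
    (hK2 : Module.finrank ℚ K = 2) {x : K} (hx : x ^ 2 = -7) (ι : K →+* ℂ)
    (e : AlgebraicClosure K →+* AlgebraicClosure ℚ) {𝔣 𝔞 : Ideal (𝓞 K)}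
    (hN𝔣 : Ideal.absNorm 𝔣 = 7 * F.d ^ 2) (h𝔣D : 𝔣 ∣ Ideal.span {((7 * F.D : ℤ) : 𝓞 K)}) [Fact (Nat.Prime 7)]
    (h𝔞 : IsTwist 7 𝔣 𝔞) {n : ℕ} {u : (AlgebraicClosure K)ˣ} (hu : IsKatoUnitRep 7 ι 𝔣 (n + 1) 𝔞 u)
    (hcov : ∀ y : AlgebraicClosure ℚ, y ∈ F.layer n →
      ∃ w : AlgebraicClosure K, w ∈ katoLayer 7 𝔣 (n + 1) ∧ e w = y)
    {Φ : AlgebraicClosure ℚ →+* ℂ} (hΦ : ∀ y : AlgebraicClosure K, Φ (e y) = algClosureEmb ι y)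
    [NeZero (7 ^ (n + 1) * F.d)] {ζ : katoLayer 7 𝔣 (n + 1)} (hζ : IsPrimitiveRoot ζ (7 ^ (n + 1) * F.d))
    (hζe : e (ζ : AlgebraicClosure K) = F.ζsys n)
    {b : (ZMod (7 ^ (n + 1) * F.d))ˣ} (hb : Φ (F.ζsys n) = rootOfUnityPow (b : ZMod (7 ^ (n + 1) * F.d)))
    (ψ : DirichletCharacter ℂ (7 ^ (n + 1) * F.d)) (hψe : ψ.Even) (hψ1 : ψ ≠ 1)
    {M : ℕ} [NeZero M] (Ψ : DirichletCharacter ℂ M) (hΨ : ∀ k : ℕ, Ψ k = ψ k * jacobiChar 7 k) (hΨo : Ψ.Odd)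
    (χ : (F.layer n ≃ₐ[ℚ] F.layer n) →* ℂˣ)
    (hread : ∀ (σ : AlgebraicClosure ℚ ≃ₐ[ℚ] AlgebraicClosure ℚ) (g : F.layer n ≃ₐ[ℚ] F.layer n) (a : ℕ),
      (∀ y : F.layer n, ((g y : F.layer n) : AlgebraicClosure ℚ) = σ y) → σ (F.ζsys n) = F.ζsys n ^ a → χ g = ψ a)
    (θ : F.layer n) (hθ : (θ : AlgebraicClosure ℚ) = e ((normOver (katoLayer 7 𝔣 (n + 1))
        (preimageField e (F.layer n) (fun k => GenusFrame.apply_algebraMap_mem_layer hK2 hx e n k))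
        ⟨u, hu.isKatoUnit.2⟩ : katoLayer 7 𝔣 (n + 1)) : AlgebraicClosure K))
    (ξ : F.layer n) (hξ : (ξ : AlgebraicClosure ℚ) = sinnottNorm (t := 7 ^ (n + 1) * F.d) (F.layer n) (F.ζsys n) 1) :
    ∑ᶠ g : F.layer n ≃ₐ[ℚ] F.layer n, ((χ g : ℂˣ) : ℂ) * (Real.log ‖Φ ((g θ : F.layer n) : AlgebraicClosure ℚ)‖ : ℂ) =
      -(1 / 2) * (((Ideal.absNorm 𝔞 : ℕ) : ℂ) - (ψ (Ideal.absNorm 𝔞))⁻¹) *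
        ((∑ a : ZMod M, (a.val : ℂ) * Ψ a) / M) * ψ b *
        ∑ᶠ g : F.layer n ≃ₐ[ℚ] F.layer n, ((χ g : ℂˣ) : ℂ) * (Real.log ‖Φ ((g ξ : F.layer n) : AlgebraicClosure ℚ)‖ : ℂ) := by
  classical
  haveI : Normal ℚ (F.layer n) := F.normal_layer n
  haveI : FiniteDimensional ℚ (F.layer n) := F.finiteDimensional_layer n
  have hKL : ∀ k : K, e (algebraMap K (AlgebraicClosure K) k) ∈ F.layer n :=
    fun k => GenusFrame.apply_algebraMap_mem_layer hK2 hx e n k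
  -- the reading at `e ζ = ζsys n`
  have hread' : ∀ (σ : AlgebraicClosure ℚ ≃ₐ[ℚ] AlgebraicClosure ℚ) (g : F.layer n ≃ₐ[ℚ] F.layer n) (a : ℕ),
      (∀ y : F.layer n, ((g y : F.layer n) : AlgebraicClosure ℚ) = σ y) →
      σ (e (ζ : AlgebraicClosure K)) = e (ζ : AlgebraicClosure K) ^ a → χ g = ψ a :=
    fun σ g a h1 h2 => hread σ g a h1 (by rw [hζe] at h2; exact h2)
  -- (i) F5 at the norm character, on the pin (File A via B1)
  have h1 := galoisLogSum_even_of_pin hF5 hK2 hx ι F.D_neg.ne hN𝔣 h𝔣D h𝔞 hu hζ ψ hψe hψ1 Ψ hΨ hΨo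
  -- (ii) the K-side regrouping along `θ = e(N_{K(𝔪ₙ)/Mₙ} u)` (B1 §5/§6): the norm character is trivial on the stabiliser
  have hStab : ∀ ρ ∈ galOver (katoLayer 7 𝔣 (n + 1)) (preimageField e (F.layer n) hKL),
      (ψ.toUnitHom.comp (hζ.autToPow K)) ρ = 1 :=
    fun ρ hρ => normCharacter_eq_one_of_mem_galOver e (F.layer n) hKL hcov hζ ψ χ hread' hρ
  have h2 := galoisLogSum_normOver_katoUnitRep F hK2 hx e hu (ψ.toUnitHom.comp (hζ.autToPow K)) hStab
  -- (iii) the conversion to `Σ_{g fixes e(K)}` (B2b §1/§2)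
  have hθ'mem : e ((normOver (katoLayer 7 𝔣 (n + 1)) (preimageField e (F.layer n) hKL)
      ⟨u, hu.isKatoUnit.2⟩ : katoLayer 7 𝔣 (n + 1)) : AlgebraicClosure K) ∈ F.layer n := by
    rw [← hθ]; exact θ.2
  have h3 := galoisLogSum_normCharacter_eq_card_mul_finsum e (F.layer n) hKL hcov hΦ hζ ψ χ hread'
    (normOver (katoLayer 7 𝔣 (n + 1)) (preimageField e (F.layer n) hKL) ⟨u, hu.isKatoUnit.2⟩) hθ'mem
  have hθeq : (⟨e ((normOver (katoLayer 7 𝔣 (n + 1)) (preimageField e (F.layer n) hKL)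
      ⟨u, hu.isKatoUnit.2⟩ : katoLayer 7 𝔣 (n + 1)) : AlgebraicClosure K), hθ'mem⟩ : F.layer n) = θ :=
    Subtype.ext hθ.symm
  rw [hθeq] at h3
  -- cancel `#Gal(K(𝔪ₙ)/Mₙ)`
  haveI : Nonempty (galOver (katoLayer 7 𝔣 (n + 1)) (preimageField e (F.layer n) hKL)) :=
    ⟨⟨1, fun y hy _ => rfl⟩⟩
  have hcard : (Nat.card (galOver (katoLayer 7 𝔣 (n + 1)) (preimageField e (F.layer n) hKL)) : ℂ) ≠ 0 := by
    exact_mod_cast (Nat.card_pos (α := galOver (katoLayer 7 𝔣 (n + 1)) (preimageField e (F.layer n) hKL))).ne'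
  have h4 := mul_left_cancel₀ hcard (h2.symm.trans h3)
  -- (iv) the halving (B2b §3) with the evenness line
  obtain ⟨c, hc⟩ := exists_complexConjugation Φ
  have hcs := complexConjugation_apply_sqrt hΦ hc hx
  have hζm : ((ζ : katoLayer 7 𝔣 (n + 1)) : AlgebraicClosure K) ^ (7 ^ (n + 1) * F.d) = 1 := by
    rw [← SubmonoidClass.coe_pow, hζ.pow_eq_one, OneMemClass.coe_one]
  have hχc := character_conj_eq_one_of_even e (F.layer n) hc hζm ψ hψe χ hread'
  have h5 := finsum_eq_two_mul_finsum_fixes hK2 hx e (F.layer n) hKL hc hcs χ hχc θ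
  -- (v) the cyclotomic side (B3a)
  have h6 := cyclotomicLogSum_eq_mul_finsum_gal (F.one_lt_level n) (F.isPrimitiveRoot_ζsys n) (F.layer n)
    (F.layer_le_adjoin_ζsys n) hb ψ χ hread ξ hξ
  -- assemble
  rw [h5, ← h4, h1, h6]
  ring

end Master

/-! ## §3 The master identity ON THE CLOSED PIN `IsNormedEllipticUnitFamily F θu` (what Files C/E consume) -/

section Pin

/-- ★★★′ **THE MASTER IDENTITY FOR A VALUE-PINNED FAMILY** (memo S6, pin closed): for `IsNormedEllipticUnitFamily F θu` and any
family `ξ n ∈ F′ₙ` with `ξ n = sinnottNorm F′ₙ (ζsys n) 1` (e.g. a genus datum's `ξu`), there are ONE complex embedding `Φ` of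
`ℚ̄` and torsor coordinates `b n ∈ (ℤ/7^{n+1}|D|)ˣ` with `Φ(ζsys n) = e^{2πi b n/mₙ}` for all `n` (spelled
`(e^{2πi/mₙ})^{(b n).val}`, no `NeZero` instance needed in the statement), such that for every level `n`,
every even Dirichlet `ψ ≠ 1` mod `mₙ` reading a character `χ` of `Gal(F′ₙ/ℚ)` at `ζsys n`, and every odd `Ψ` with
`Ψ(k) = ψ(k)(k/7)`:
`Σ_g χ(g) log‖Φ(g·θu n)‖ = −½·(N𝔞 − ψ(N𝔞)⁻¹)·((Σ_{a mod M} a·Ψ(a))/M)·ψ(b n)·Σ_g χ(g) log‖Φ(g·ξ n)‖` (`N𝔞 = F.normA`).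
CONDITIONAL on F5 only. [cite: Kato2004Asterisque, §15.5 (15.5.1) (p. 253)] [cite: Lang1990, Ch. 3 §5 Lemma 1 (PDF p. 71)] -/
theorem exists_masterIdentity_of_isNormedEllipticUnitFamily (hF5 : Kato2004.kato1551_kroneckerLimitFormula) (F : GenusFrame)
    {θu : ∀ n : ℕ, globalUnitsOf (F.layer n)} (hθu : IsNormedEllipticUnitFamily F θu)
    (ξ : ∀ n : ℕ, F.layer n)
    (hξ : ∀ n : ℕ, ((ξ n : F.layer n) : AlgebraicClosure ℚ) = sinnottNorm (t := 7 ^ (n + 1) * F.d) (F.layer n) (F.ζsys n) 1) :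
    ∃ (Φ : AlgebraicClosure ℚ →+* ℂ) (b : ∀ n : ℕ, (ZMod (7 ^ (n + 1) * F.d))ˣ),
      (∀ n : ℕ, Φ (F.ζsys n) =
        Complex.exp (2 * Real.pi * Complex.I / (7 ^ (n + 1) * F.d : ℕ)) ^ ((b n : ZMod (7 ^ (n + 1) * F.d))).val) ∧
      ∀ (n : ℕ) (ψ : DirichletCharacter ℂ (7 ^ (n + 1) * F.d)), ψ.Even → ψ ≠ 1 →
        ∀ {M : ℕ} [NeZero M] (Ψ : DirichletCharacter ℂ M), (∀ k : ℕ, Ψ k = ψ k * jacobiChar 7 k) → Ψ.Odd →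
        ∀ (χ : (F.layer n ≃ₐ[ℚ] F.layer n) →* ℂˣ),
          (∀ (σ : AlgebraicClosure ℚ ≃ₐ[ℚ] AlgebraicClosure ℚ) (g : F.layer n ≃ₐ[ℚ] F.layer n) (a : ℕ),
            (∀ y : F.layer n, ((g y : F.layer n) : AlgebraicClosure ℚ) = σ y) → σ (F.ζsys n) = F.ζsys n ^ a → χ g = ψ a) →
          ∑ᶠ g : F.layer n ≃ₐ[ℚ] F.layer n, ((χ g : ℂˣ) : ℂ) *
              (Real.log ‖Φ ((g ((toFieldUnits (F.layer n) (θu n) : (F.layer n : Type)ˣ) : F.layer n) : F.layer n) :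
                AlgebraicClosure ℚ)‖ : ℂ) =
            -(1 / 2) * ((F.normA : ℂ) - (ψ F.normA)⁻¹) * ((∑ a : ZMod M, (a.val : ℂ) * Ψ a) / M) * ψ (b n) *
              ∑ᶠ g : F.layer n ≃ₐ[ℚ] F.layer n, ((χ g : ℂˣ) : ℂ) *
                (Real.log ‖Φ ((g (ξ n) : F.layer n) : AlgebraicClosure ℚ)‖ : ℂ) := by
  obtain ⟨K, _, _, s, ι, e, 𝔣, 𝔞, z, hz, hK2, hs, hN𝔣, h𝔣D, h𝔞, hN𝔞, hcov, hθ⟩ := hθu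
  haveI : Fact (Nat.Prime 7) := ⟨Nat.prime_seven⟩
  obtain ⟨Φ, hΦ⟩ := exists_complexEmbedding_extends e ι
  have hne : ∀ n : ℕ, NeZero (7 ^ (n + 1) * F.d) := fun n => ⟨(Nat.lt_trans zero_lt_one (F.one_lt_level n)).ne'⟩
  choose b hb using fun n : ℕ => haveI := hne n; exists_unit_rootOfUnityPow_eq (F.isPrimitiveRoot_ζsys n) Φ
  refine ⟨Φ, b, fun n => ?_, fun n ψ hψe hψ1 M _ Ψ hΨ hΨo χ hread => ?_⟩
  · haveI := hne n
    rw [hb n, Literature.NumberTheory.IwasawaTheory.CyclotomicUnits.rootOfUnityPow_eq_cexp_pow]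
  haveI := hne n
  obtain ⟨ζ, hζ, hζe⟩ := exists_alignedRoot F hK2 hs e hN𝔣 h𝔣D n
  have hθN := coe_family_eq_map_normOver F hK2 hs e hz hθ n
  have h := sum_log_theta_eq_genus_mul_sum_log_xi hF5 F hK2 hs ι e hN𝔣 h𝔣D h𝔞 (hz n) (hcov n) hΦ hζ hζe (hb n) ψ hψe hψ1
    Ψ hΨ hΨo χ hread ((toFieldUnits (F.layer n) (θu n) : (F.layer n : Type)ˣ) : F.layer n)
    (by rw [coe_coe_toFieldUnits]; exact hθN) (ξ n) (hξ n)
  rw [hN𝔞] at h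
  exact h

end Pin

end Summit.BirchSwinnertonDyer.Rank1Residual.Additive.GenusSeven

end
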